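import Summits.QuantumAdvantage.QuantumAdvantage.Theses.SpinorFlattening
import Summits.QuantumAdvantage.QuantumAdvantage.Theorems.SpinorFlatteningNegApproxGaussRankSuperpolyMassBound
import Summits.QuantumAdvantage.QuantumAdvantage.Theorems.SpinorFlatteningNegApproxGaussRankSuperpolyNormalOrder
import Summits.QuantumAdvantage.QuantumAdvantage.Theorems.SpinorFlatteningNegApproxGaussRankSuperpolyFilterCard
import Summits.QuantumAdvantage.QuantumAdvantage.Theorems.SpinorFlatteningNegApproxGaussRankSuperpolyFlatOrthoOfInvariant
import Summits.QuantumAdvantage.QuantumAdvantage.Theorems.SpinorFlatteningNegApproxGaussRankSuperpolyMagicInvariant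
import Summits.QuantumAdvantage.QuantumAdvantage.Theorems.SpinorFlatteningNegApproxGaussRankSuperpolyCountGap
import Literature.Computability.QuantumComplexity.GaussianRank

/-!
# Crux `SpinorFlattening.FlatteningBoundRobust` (stmt-QuantumAdvantage-1246) — line `mass-bound-corollary`

Crux-plan skeleton (planner-cruxplan-stmt-QuantumAdvantage-1246-mass-bound-corollary-0, 2026-08-16) for the
idea `Ideas/mass-bound-corollary.md` (triage r1: 3/3 pass, merged with `isometric-subflattening-deficit` /
`isometric-subflattening-bessel` — one lever).  **STATUS: CLOSED LINE — 0 `sorry`.**  Both stubs of the line are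
compositions of theorems that LANDED for the sibling kill-crux 1245 (line `spectral-mass-flattening`), so they
are PROVED in this file rather than sorried; `FlatteningBoundRobust_of` concludes the crux BY NAME.

## The crux (named API; the route's inline `maj`/`IsGauss`/`Mpow`/parity-binomial sum are definitionally
`majorana`/`IsGaussian`/`magicMPow`/`flatteningDeficiency`, cf. Disproof.lean §0 `flatteningBoundRobust_iff`)
  `∀ t K r, r·D_K(4t) < C(t,K)·8^K → ∀ a g, (∀ i, IsGaussian (g i)) → 1 ≤ C(8t,K)·normSq(M^{⊗t} − Σ aᵢ•gᵢ)`.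

## The line — Bessel tail on the FLAT one-Majorana-per-block sub-flattening (not Weyl on one singular value)
Index the degree-`K` flat family by `ι = Σ (B : K-subset of the t blocks), (B → Fin 4 × Bool)` (`|ι| = C(t,K)·8^K`
exactly, landed `countGap_card_sigma`); the column of `x : ι` is the block monomial `mono (flatPattern x)` — the
ordered product of ONE Jordan–Wigner Majorana per excited block.
* `stub_deficiency` (r-term NORMAL-ORDERING DEFICIENCY): every degree-`K` Majorana word applied to an `r`-term
  Gaussian combination lies in ONE subspace `W`, `dim W ≤ r·D_K(n)` — composed from the landed `stub_normalOrder`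
  (p75761) + `stub_filterCard` (p74182).
* `stub_flatOrthonormal` (FULLNESS): the block-monomial images of `M^{⊗t}` are orthonormal — composed from the
  landed `stub_flatOrthoOfInvariant` (p74600) + `stub_magicInvariant` (p74598).
* mass bound (the lever; landed `stub_massBound`, p71968): `|ι| − dim W ≤ |ι|·normSq(ψ − φ)` for a unitary family
  with orthonormal images of `ψ` and images of `φ` inside `W`.
* counting glue (proved here): `flatPattern` injective with support `K`; `C(t,K)·8^K ≤ C(8t,K)`
  (`choose_mul_eight_pow_le`, the descFactorial proof of Disproof.lean §F).
Composition: `flatteningBoundBessel_of_parts` gives the SHARP form `C(t,K)8^K − r·D_K(4t) ≤ C(t,K)8^K·normSq(M^{⊗t} − φ)`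
(hypothesis-free; attained at (t,K,r) = (1,1,1): Disproof §C `massBound_attained_t1`); with the STRICT count
(`r·D + 1 ≤ C(t,K)8^K`, Disproof §A `_false_with_le`) and `C(t,K)8^K ≤ C(8t,K)` this is the crux
(`flatteningBoundRobust_of_parts`, `FlatteningBoundRobust_of`).  By-product: `FlatteningBoundExact_of` (item 1249).

## To land (lead prover): copy this file to `Theorems/SpinorFlatteningFlatteningBoundRobust.lean`, replace the
`namespace`/`end` lines by `Summit.QuantumAdvantage.QuantumAdvantage.Theorems.SpinorFlattening` (every short name
below is fresh there — `lean search`, 2026-08-16; do NOT also import `…Theorems.SpinorFlatteningNegApproxGaussRankSuperpoly`,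
whose `deficiency`/`flatOrthonormal` are the same two compositions), and
`ledger propose --kind proof --target Summits/QuantumAdvantage/QuantumAdvantage/Theorems/SpinorFlatteningFlatteningBoundRobust.lean
 --file … --workitem stmt-QuantumAdvantage-1246` (then 1249 closes by `FlatteningBoundExact_of`).
-/

noncomputable section

set_option linter.dupNamespace false -- D-0017: single-conjunct summit ⇒ `QuantumAdvantage.QuantumAdvantage` by design

namespace Summit.QuantumAdvantage.QuantumAdvantage.Cruxes.FlatteningBoundRobust.MassBoundCorollary

open Matrix Finset
open Literature.Computability.QuantumComplexity Literature.Computability.Cryptography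
open Summit.QuantumAdvantage.QuantumAdvantage.Theorems.SpinorFlattening

/-! ## Stub 1 — r-term normal-ordering deficiency (CLOSED: landed `stub_normalOrder` + `stub_filterCard`) -/

/-- **stub_deficiency** (NORMAL-ORDERING DEFICIENCY of the Clifford-multiplication flattening on `r`-term
Gaussian combinations): for Gaussian `g₁ … g_r` on `n` qubits and any coefficients there is ONE subspace
`W` with `dim W ≤ r · D_K(n)` containing `c_{p₁} ⋯ c_{p_K} (Σ aᵢ gᵢ)` for EVERY list `[p₁, …, p_K]` of `K`
Majorana labels (`W` = span of the sorted complement words of all the `gᵢ`; each `gᵢ` contributes at most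
`#{I ⊆ Fin n : |I| ≤ K, |I| ≡ K (2)} = D_K(n)` of them).  Honours Disproof §A `_false_without_gauss` /
`_false_without_linIndep` (the `n` INDEPENDENT annihilators are what cap the complement at `n` letters) and
§A5 `_false_with_deficiency_pred` (the constant is exactly `D_K`). -/
theorem stub_deficiency :
    ∀ (n K r : ℕ) (a : Fin r → ℂ) (g : Fin r → QReg n → ℂ), (∀ i, IsGaussian (g i)) →
      ∃ W : Submodule ℂ (QReg n → ℂ), Module.finrank ℂ W ≤ r * flatteningDeficiency K n ∧
        ∀ l : List (Fin n × Bool), l.length = K →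
          (l.map fun p => majorana n p.1 p.2).prod *ᵥ (∑ i, a i • g i) ∈ W := by
  intro n K r a g hg
  classical
  choose u hu using fun i => stub_normalOrder n K (g i) (hg i)
  let ι : Type := {I : Finset (Fin n) // I.card ≤ K ∧ I.card % 2 = K % 2}
  let f : Fin r → ι → (QReg n → ℂ) := fun i I =>
    ((I.1.sort (· ≤ ·)).map fun j => ∑ p : Fin n × Bool, u i j p • majorana n p.1 p.2).prod *ᵥ g i
  let F : Fin r × ι → (QReg n → ℂ) := fun x => f x.1 x.2
  refine ⟨Submodule.span ℂ (Set.range F), ?_, ?_⟩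
  · calc Module.finrank ℂ (Submodule.span ℂ (Set.range F)) ≤ Fintype.card (Fin r × ι) :=
          finrank_range_le_card F
      _ = r * flatteningDeficiency K n := by rw [Fintype.card_prod, Fintype.card_fin, stub_filterCard]
  · intro l hl
    rw [Matrix.mulVec_sum]
    refine Submodule.sum_mem _ fun i _ => ?_
    rw [Matrix.mulVec_smul]
    refine Submodule.smul_mem _ _ ?_
    have hsub : Submodule.span ℂ (Set.range (f i)) ≤ Submodule.span ℂ (Set.range F) :=
      Submodule.span_mono (by
        rintro _ ⟨I, rfl⟩
        exact ⟨(i, I), rfl⟩)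
    exact hsub (hu i l hl)

/-! ## Stub 2 — orthonormality of the flat family (CLOSED: landed `stub_flatOrthoOfInvariant` + `stub_magicInvariant`) -/

/-- **stub_flatOrthonormal** (FULLNESS): for every block pattern `s : Fin t → Option (Fin 4 × Bool)` let
`mono s` be the ordered product (increasing block order) of the Jordan–Wigner Majoranas it excites, one per
excited block; then the images `mono s *ᵥ M^{⊗t}` are unit vectors and pairwise orthogonal (symmetry-sign
argument on the block `X⊗X⊗X⊗X` strings and the in-block `Z Z` pairs fixing `M^{⊗t}`). -/
theorem stub_flatOrthonormal :
    ∀ (t : ℕ) (mono : (Fin t → Option (Fin 4 × Bool)) → Matrix (QReg (t * 4)) (QReg (t * 4)) ℂ),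
      (∀ s, mono s = ((List.finRange t).filterMap fun b =>
          (s b).map fun q => majorana (t * 4) (finProdFinEquiv (b, q.1)) q.2).prod) →
      (∀ s, star (mono s *ᵥ magicMPow t) ⬝ᵥ (mono s *ᵥ magicMPow t) = 1) ∧
        ∀ s s', s ≠ s' → star (mono s *ᵥ magicMPow t) ⬝ᵥ (mono s' *ᵥ magicMPow t) = 0 := by
  intro t mono hmono
  obtain ⟨hX, hZ, h1⟩ := stub_magicInvariant t
  exact stub_flatOrthoOfInvariant t mono hmono (magicMPow t) hX hZ h1

/-! ## Counting glue (proved) -/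

/-- The labels excited by a block pattern have as many entries as there are excited blocks. -/
theorem flat_labels_length (t : ℕ) (s : Fin t → Option (Fin 4 × Bool)) :
    ((List.finRange t).filterMap fun b =>
        (s b).map fun q => ((finProdFinEquiv (b, q.1) : Fin (t * 4)), q.2)).length =
      (univ.filter fun b => (s b).isSome).card := by
  classical
  have key : ∀ L : List (Fin t), (L.filterMap fun b =>
      (s b).map fun q => ((finProdFinEquiv (b, q.1) : Fin (t * 4)), q.2)).length =
        (L.filter fun b => (s b).isSome).length := by
    intro L
    induction L with
    | nil => simp
    | cons b L ih =>
      cases hb : s b with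
      | none => simp [hb, ih]
      | some q => simp [hb, ih]
  rw [key, ← List.toFinset_card_of_nodup ((List.nodup_finRange t).filter _)]
  congr 1
  ext b
  simp

/-- The block pattern of a (`K`-subset of blocks, labelling) pair: `some (label b)` on `B`, `none` off `B`. -/
def flatPattern {t K : ℕ} (x : Σ B : {B : Finset (Fin t) // B.card = K}, (B.1 → Fin 4 × Bool)) :
    Fin t → Option (Fin 4 × Bool) :=
  fun b => if h : b ∈ x.1.1 then some (x.2 ⟨b, h⟩) else none

/-- The pattern determines the pair. -/
theorem flatPattern_injective (t K : ℕ) :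
    Function.Injective (flatPattern (t := t) (K := K)) := by
  rintro ⟨⟨B, hB⟩, f⟩ ⟨⟨B', hB'⟩, f'⟩ h
  have h' : (fun b => if h : b ∈ B then some (f ⟨b, h⟩) else none) =
      fun b => if h : b ∈ B' then some (f' ⟨b, h⟩) else none := h
  have hBB : B = B' := by
    ext b
    have hb : (if h : b ∈ B then some (f ⟨b, h⟩) else none) =
        if h : b ∈ B' then some (f' ⟨b, h⟩) else none := congrFun h' b
    constructor
    · intro h1
      by_contra h2
      rw [dif_pos h1, dif_neg h2] at hb
      exact Option.some_ne_none _ hb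
    · intro h2
      by_contra h1
      rw [dif_neg h1, dif_pos h2] at hb
      exact Option.some_ne_none _ hb.symm
  subst hBB
  have hff : f = f' := by
    funext x
    obtain ⟨b, hb⟩ := x
    have hx : (if h : b ∈ B then some (f ⟨b, h⟩) else none) =
        if h : b ∈ B then some (f' ⟨b, h⟩) else none := congrFun h' b
    rw [dif_pos hb, dif_pos hb, Option.some.injEq] at hx
    exact hx
  subst hff
  rfl

/-- The pattern of a pair excites exactly `K` blocks. -/
theorem flatPattern_support {t K : ℕ} (x : Σ B : {B : Finset (Fin t) // B.card = K}, (B.1 → Fin 4 × Bool)) :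
    (univ.filter fun b => (flatPattern x b).isSome).card = K := by
  unfold flatPattern
  rw [countGap_pattern_support]
  exact x.1.2

/-- `C(t,K) · 8^K ≤ C(8t,K)` — termwise `8(t−i) ≤ 8t−i` in the falling factorials (the descFactorial proof
of Disproof.lean §F `choose_mul_eight_pow_le`, refuter-cdisprove-stmt-QuantumAdvantage-1246-0). [folklore] -/
theorem choose_mul_eight_pow_le (t K : ℕ) : t.choose K * 8 ^ K ≤ (t * 8).choose K := by
  have h1 : t.descFactorial K * 8 ^ K ≤ (t * 8).descFactorial K := by
    rw [Nat.descFactorial_eq_prod_range, Nat.descFactorial_eq_prod_range, ← Finset.card_range K,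
      ← Finset.prod_const, Finset.card_range, ← Finset.prod_mul_distrib]
    apply Finset.prod_le_prod'
    intro i _
    rcases le_or_gt i t with h | h
    · have : (t - i) * 8 = t * 8 - i * 8 := Nat.sub_mul t i 8
      rw [this]
      apply Nat.sub_le_sub_left
      omega
    · rw [Nat.sub_eq_zero_of_le (Nat.le_of_lt h), zero_mul]
      exact Nat.zero_le _
  rw [Nat.choose_eq_descFactorial_div_factorial, Nat.choose_eq_descFactorial_div_factorial]
  calc t.descFactorial K / K.factorial * 8 ^ K
      = 8 ^ K * (t.descFactorial K / K.factorial) := mul_comm _ _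
    _ ≤ 8 ^ K * t.descFactorial K / K.factorial := Nat.mul_div_le_mul_div_assoc _ _ _
    _ = t.descFactorial K * 8 ^ K / K.factorial := by rw [mul_comm]
    _ ≤ (t * 8).descFactorial K / K.factorial := Nat.div_le_div_right h1

/-! ## Composition -/

/-- **Sharp (mass-bound / C⁺) form over the three part STATEMENTS**: deficiency → fullness → mass bound ⇒
`C(t,K)8^K − r·D_K(4t) ≤ C(t,K)8^K · normSq(M^{⊗t} − Σ aᵢ•gᵢ)` for ALL `t K r` (no count hypothesis). -/
theorem flatteningBoundBessel_of_parts (hD : type_of% stub_deficiency) (hO : type_of% stub_flatOrthonormal)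
    (hB : type_of% stub_massBound) :
    ∀ (t K r : ℕ) (a : Fin r → ℂ) (g : Fin r → QReg (t * 4) → ℂ), (∀ i, IsGaussian (g i)) →
      ((t.choose K * 8 ^ K : ℕ) : ℝ) - ((r * flatteningDeficiency K (t * 4) : ℕ) : ℝ)
        ≤ ((t.choose K * 8 ^ K : ℕ) : ℝ) * normSq (magicMPow t - ∑ i, a i • g i) := by
  classical
  intro t K r a g hg
  -- the flat family: labels, monomials, index type
  let lab : (Fin t → Option (Fin 4 × Bool)) → List (Fin (t * 4) × Bool) := fun s =>
    (List.finRange t).filterMap fun b => (s b).map fun q => (finProdFinEquiv (b, q.1), q.2)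
  let mono : (Fin t → Option (Fin 4 × Bool)) → Matrix (QReg (t * 4)) (QReg (t * 4)) ℂ := fun s =>
    ((List.finRange t).filterMap fun b =>
      (s b).map fun q => majorana (t * 4) (finProdFinEquiv (b, q.1)) q.2).prod
  have hmono_lab : ∀ s, mono s = ((lab s).map fun p => majorana (t * 4) p.1 p.2).prod := by
    intro s
    simp only [mono, lab, List.map_filterMap, Option.map_map]
    rfl
  let ι : Type := Σ B : {B : Finset (Fin t) // B.card = K}, (B.1 → Fin 4 × Bool)
  -- deficiency: one subspace W of dimension ≤ r·D_K(4t) holds every degree-K monomial image of φ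
  obtain ⟨W, hW, hmem⟩ := hD (t * 4) K r a g hg
  -- unitarity of the monomials
  have hunit : ∀ s, mono s ∈ Matrix.unitaryGroup (QReg (t * 4)) ℂ := by
    intro s
    rw [hmono_lab]
    refine list_prod_mem ?_
    intro x hx
    obtain ⟨p, -, rfl⟩ := List.mem_map.1 hx
    exact majorana_mem_unitaryGroup _ _ _
  -- orthonormality of the images of M^{⊗t}
  obtain ⟨hO1, hO2⟩ := hO t mono (fun s => rfl)
  -- the mass bound over the Σ-indexed degree-K family
  have hmass := hB (t * 4) ι (fun x => mono (flatPattern x)) (magicMPow t) (∑ i, a i • g i) W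
    (fun x => hunit _) (fun x => hO1 _)
    (fun x y hxy => hO2 _ _ fun h => hxy (flatPattern_injective t K h))
    (fun x => by
      show mono (flatPattern x) *ᵥ _ ∈ W
      rw [hmono_lab]
      exact hmem (lab (flatPattern x))
        ((flat_labels_length t (flatPattern x)).trans (flatPattern_support x)))
  -- counting: |ι| = C(t,K)·8^K exactly, dim W ≤ r·D_K(4t)
  have hcardι : Fintype.card ι = t.choose K * 8 ^ K := countGap_card_sigma t K
  have hWR : (Module.finrank ℂ W : ℝ) ≤ ((r * flatteningDeficiency K (t * 4) : ℕ) : ℝ) := by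
    exact_mod_cast hW
  rw [hcardι] at hmass
  push_cast at hmass hWR ⊢
  linarith

/-- **The robust bound over the three part STATEMENTS** (named-API form of the crux): the sharp form, the
STRICT count `r·D_K(4t) + 1 ≤ C(t,K)·8^K` (Disproof §A: with `≤` the statement is false at (1,1,2)) and
`C(t,K)·8^K ≤ C(8t,K)`. -/
theorem flatteningBoundRobust_of_parts (hD : type_of% stub_deficiency) (hO : type_of% stub_flatOrthonormal)
    (hB : type_of% stub_massBound) :
    ∀ t K r : ℕ, r * flatteningDeficiency K (t * 4) < t.choose K * 8 ^ K →
      ∀ (a : Fin r → ℂ) (g : Fin r → QReg (t * 4) → ℂ), (∀ i, IsGaussian (g i)) →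
        (1 : ℝ) ≤ ((t * 8).choose K : ℝ) * normSq (magicMPow t - ∑ i, a i • g i) := by
  intro t K r hcount a g hg
  have hb := flatteningBoundBessel_of_parts hD hO hB t K r a g hg
  have h1 : ((r * flatteningDeficiency K (t * 4) : ℕ) : ℝ) + 1 ≤ ((t.choose K * 8 ^ K : ℕ) : ℝ) := by
    exact_mod_cast (Nat.succ_le_of_lt hcount)
  have hnn : 0 ≤ normSq (magicMPow t - ∑ i, a i • g i) :=
    Finset.sum_nonneg fun _ _ => by positivity
  have hle : ((t.choose K * 8 ^ K : ℕ) : ℝ) ≤ ((t * 8).choose K : ℝ) := by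
    exact_mod_cast choose_mul_eight_pow_le t K
  calc (1 : ℝ) ≤ ((t.choose K * 8 ^ K : ℕ) : ℝ) - ((r * flatteningDeficiency K (t * 4) : ℕ) : ℝ) := by
        linarith
    _ ≤ ((t.choose K * 8 ^ K : ℕ) : ℝ) * normSq (magicMPow t - ∑ i, a i • g i) := hb
    _ ≤ ((t * 8).choose K : ℝ) * normSq (magicMPow t - ∑ i, a i • g i) :=
        mul_le_mul_of_nonneg_right hle hnn

/-- **THE SKELETON THEOREM — concludes the crux `SpinorFlattening.FlatteningBoundRobust` BY NAME** from the two
stubs of this line and the landed `stub_massBound`; accepted by `exact` because the route's inline vocabulary is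
definitionally the named API. -/
theorem FlatteningBoundRobust_of :
    Summit.QuantumAdvantage.QuantumAdvantage.Theses.SpinorFlattening.FlatteningBoundRobust :=
  flatteningBoundRobust_of_parts stub_deficiency stub_flatOrthonormal stub_massBound

/-! ## By-products (not needed for the crux) -/

/-- The SHARP form, hypothesis-free: `C(t,K)8^K − r·D_K(4t) ≤ C(t,K)8^K · normSq(M^{⊗t} − φ)` (= `FlatteningBoundBessel`
of the crux workfile Transfer.lean, whence also the kill crux 1245 by `Transfer.negApprox_of_bessel'`; attained at
(1,1,1) by Disproof §C `massBound_attained_t1`). -/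
theorem flatteningBoundBessel :
    ∀ (t K r : ℕ) (a : Fin r → ℂ) (g : Fin r → QReg (t * 4) → ℂ), (∀ i, IsGaussian (g i)) →
      ((t.choose K * 8 ^ K : ℕ) : ℝ) - ((r * flatteningDeficiency K (t * 4) : ℕ) : ℝ)
        ≤ ((t.choose K * 8 ^ K : ℕ) : ℝ) * normSq (magicMPow t - ∑ i, a i • g i) :=
  flatteningBoundBessel_of_parts stub_deficiency stub_flatOrthonormal stub_massBound

/-- Support item `SpinorFlattening.FlatteningBoundExact` (stmt-QuantumAdvantage-1249), the `δ = 0` core: under the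
count, `M^{⊗t}` is not an `r`-term Gaussian combination — read off the SHARP form `flatteningBoundBessel`
(`M^{⊗t} = φ` ⇒ `C(t,K)8^K − r·D_K(4t) ≤ 0`, against `r·D_K(4t) + 1 ≤ C(t,K)8^K`). -/
theorem FlatteningBoundExact_of :
    Summit.QuantumAdvantage.QuantumAdvantage.Theses.SpinorFlattening.FlatteningBoundExact := by
  classical
  show ∀ t K r : ℕ, r * flatteningDeficiency K (t * 4) < t.choose K * 8 ^ K →
    ∀ (a : Fin r → ℂ) (g : Fin r → QReg (t * 4) → ℂ), (∀ i, IsGaussian (g i)) →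
      magicMPow t ≠ ∑ i, a i • g i
  intro t K r hcount a g hg heq
  -- from the SHARP form: `C(t,K)8^K − r·D ≤ C(t,K)8^K · normSq 0 = 0` contradicts the strict count
  have key := flatteningBoundBessel t K r a g hg
  have h0 : normSq (magicMPow t - ∑ i, a i • g i) = 0 := by
    rw [← heq, sub_self]
    simp [normSq]
  have h1 : ((r * flatteningDeficiency K (t * 4) : ℕ) : ℝ) + 1 ≤ ((t.choose K * 8 ^ K : ℕ) : ℝ) := by
    exact_mod_cast (Nat.succ_le_of_lt hcount)
  rw [h0, mul_zero] at key
  linarith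

end Summit.QuantumAdvantage.QuantumAdvantage.Cruxes.FlatteningBoundRobust.MassBoundCorollary

end
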